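import Mathlib.Data.Finset.Card
import Mathlib.Data.Fintype.Basic
import Mathlib.Data.Nat.Find
import HarnessLib

/-!
# [GenEll] Thm. 2.1 (ii) ⇒ (i) for `ℙ¹`: signatures for the finite MENU (the hypotheses of the menu
# pigeonhole, from per-level freshness off torsion loci)

S. Mochizuki, *Arithmetic elliptic curves in general position*, Math. J. Okayama Univ. 52 (2010)
[cite: MochizukiGenEll2010, Thm 2.1 p.12]: in the proof of Thm. 2.1 (p. 12) finitely many noncritical
Belyi maps suffice by compactness. In the number-field route to `GenEllTwo` (abc-iut cell, abc-iut-S6's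
`GENELLTWO-P1ROUTE.md` §4, work package W8) the maps form an explicit finite MENU of depth-`k`
composites `γ_i = g_{k-1, i(k-1)} ∘ ⋯ ∘ g_{0, i 0}` of cusp-preserving self-maps of `ℙ¹`
(`i : Fin k → Fin n`: one of `n` exponents at each of `k` levels, level `0` applied first), and the
compactness step becomes the pigeonhole `GenEllMenuCover.exists_forall_not_mem_of_signature`: if every
point `z` carries a nonempty "signature" of (level, exponent) pairs such that `z` is bad for `γ_i`
(`γ_i z ∈ X`) only when `i` uses those exponents at those levels, then fewer than `n` slots leave some
`γ_i` with no bad slot.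

This file PRODUCES those signatures from the arithmetic of the families, abstracted to one hypothesis
per level («freshness off the torsion locus»): at level `l`, if two DISTINCT exponents `e ≠ e'` both send
`z` into the level-`l` target set `Y_l = {w | some deeper composite maps w into X}`, then `z` lies on the
torsion locus `T_l` of the family AND the whole family fixes `z` (for the power family `z ↦ z^p` with
primes `p ≡ 1 (mod O)` outside finitely many bad pairs this is Kronecker + heights, sibling files
`KroneckerHeightZero` / `PowerMapPreimageFreshness` of abc-iut-w4-d065; the loci meet as in
abc-iut-w4-d069's torsion-loci file). Together with «no point of `X` lies on all `k` loci» this gives: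

* `exists_signature` — every `z : B` has a nonempty signature valid for all indices `i` (the two
  hypotheses `hsig`, `hne` of `exists_forall_not_mem_of_signature`, for ALL points, cusps included).

The composite-runner `run i l m` (apply levels `l, …, l+m-1` of index `i`) is taken ABSTRACTLY through
its two defining equations, so this file has no definitions; the menu owner instantiates it with the six
families (`x^p`, `1−(1−x)^p`, the `x/(x−1)`-conjugate, three Chebyshev) in `GenEllMenuInstances`.
Theorems only; elementary; nothing here touches [IUTchIII].
-/

namespace Literature.NumberTheory.DiophantineGeometry.GenEll

namespace Menu

variable {B : Type*} {k n : ℕ}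

/-- Transparent prefixes can be skipped: if every map of the levels `l, …, l+j-1` fixes `z`, then
running `j + m` levels from level `l` on `z` is running `m` levels from level `l + j` on `z`.
(Bookkeeping for the menu of [GenEll] Thm. 2.1's finite-cover step.) [cite: MochizukiGenEll2010, Thm 2.1 p.12] -/
theorem run_add_of_fixed (g : ℕ → Fin n → B → B) (run : (Fin k → Fin n) → ℕ → ℕ → B → B)
    (run_succ : ∀ i l m z (hl : l < k), run i l (m + 1) z = run i (l + 1) m (g l (i ⟨l, hl⟩) z))
    (i : Fin k → Fin n) (z : B) :
    ∀ (j l m : ℕ), l + j ≤ k → (∀ l', l ≤ l' → l' < l + j → ∀ e : Fin n, g l' e z = z) →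
      run i l (j + m) z = run i (l + j) m z := by
  intro j
  induction j with
  | zero =>
    intro l m _ _
    simp
  | succ j ih =>
    intro l m hlj hfix
    have hl : l < k := by omega
    have h1 : run i l (j + 1 + m) z = run i (l + 1) (j + m) (g l (i ⟨l, hl⟩) z) := by
      rw [show j + 1 + m = (j + m) + 1 by omega]
      exact run_succ i l (j + m) z hl
    have h2 : g l (i ⟨l, hl⟩) z = z := hfix l le_rfl (by omega) _
    rw [h1, h2, ih (l + 1) m (by omega) (fun l' h1' h2' e => hfix l' (by omega) (by omega) e)]
    congr 1
    omega

/-- **Signatures for the menu.** Levels `0, …, k-1` (`0 < k`), `n ≥ 2` exponents per level, family maps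
`g l e : B → B`, an abstract composite-runner `run i l m` (apply levels `l, …, l+m-1` of the index
`i : Fin k → Fin n`, level `l` first) given by its two equations, a target set `X` and torsion loci `T l`.
HYPOTHESES: (freshness off the torsion locus) at each level `l < k`, two distinct exponents both sending
`z` into the level-`l` target `{w | ∃ i, run i (l+1) (k-(l+1)) w ∈ X}` force `z ∈ T l` and `g l e z = z`
for every exponent `e`; (loci) no point of `X` lies on all the `T l`, `l < k`. CONCLUSION: a signature
`sig : B → Finset (Fin k × Fin n)`, nonempty at EVERY point, with `run i 0 k z ∈ X → i l = e` for all
`(l, e) ∈ sig z` — exactly the hypotheses of the menu pigeonhole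
`exists_forall_not_mem_of_signature` (with `Z i = {z | run i 0 k z ∈ X}`). Proof: at the first level
`L` not fixing `z`, at most one exponent hits the target (freshness), and it is forced; if every level
fixes `z` then `z` is bad only if `z ∈ X`, and then freshness at every level puts `z` on all loci,
excluded. (Finite-menu form of the compactness step of [GenEll] Thm. 2.1, p. 12.)
[cite: MochizukiGenEll2010, Thm 2.1 p.12] -/
theorem exists_signature (hk : 0 < k) (hn : 1 < n)
    (g : ℕ → Fin n → B → B) (run : (Fin k → Fin n) → ℕ → ℕ → B → B)
    (run_zero : ∀ i l z, run i l 0 z = z)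
    (run_succ : ∀ i l m z (hl : l < k), run i l (m + 1) z = run i (l + 1) m (g l (i ⟨l, hl⟩) z))
    (X : Set B) (T : ℕ → Set B)
    (hfresh : ∀ (l : ℕ) (_ : l < k) (e e' : Fin n), e ≠ e' → ∀ z : B,
        (∃ i : Fin k → Fin n, run i (l + 1) (k - (l + 1)) (g l e z) ∈ X) →
        (∃ i : Fin k → Fin n, run i (l + 1) (k - (l + 1)) (g l e' z) ∈ X) →
          z ∈ T l ∧ ∀ e'' : Fin n, g l e'' z = z)
    (hT : ∀ z ∈ X, ∃ l < k, z ∉ T l) :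
    ∃ sig : B → Finset (Fin k × Fin n),
      (∀ (z : B) (i : Fin k → Fin n), run i 0 k z ∈ X → ∀ le ∈ sig z, i le.1 = le.2) ∧
      ∀ z, (sig z).Nonempty := by
  classical
  -- pointwise form
  suffices hpt : ∀ z : B, ∃ s : Finset (Fin k × Fin n), s.Nonempty ∧
      ∀ i : Fin k → Fin n, run i 0 k z ∈ X → ∀ le ∈ s, i le.1 = le.2 by
    choose sig hne hsig using hpt
    exact ⟨sig, fun z i hz le hle => hsig z i hz le hle, hne⟩
  intro z
  have e₀ : Fin n := ⟨0, by omega⟩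
  -- transparent prefixes
  have hskip := run_add_of_fixed g run run_succ
  by_cases hA : ∃ l, l < k ∧ ¬ ∀ e : Fin n, g l e z = z
  · -- Case A: `L` = the first level whose family does not fix `z`
    let L := Nat.find hA
    have hL : L < k ∧ ¬ ∀ e : Fin n, g L e z = z := Nat.find_spec hA
    have hmin : ∀ l', l' < L → ∀ e : Fin n, g l' e z = z := by
      intro l' hl'
      have := Nat.find_min hA hl'
      push Not at this
      exact this (lt_trans hl' hL.1)
    -- every index that is bad at `z` hits the level-`L` target with its level-`L` exponent
    have key : ∀ i : Fin k → Fin n, run i 0 k z ∈ X →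
        run i (L + 1) (k - (L + 1)) (g L (i ⟨L, hL.1⟩) z) ∈ X := by
      intro i hz
      have h1 : run i 0 (L + (k - L)) z = run i (0 + L) (k - L) z :=
        hskip i z L 0 (k - L) (by omega) (fun l' _ hl' e => hmin l' (by omega) e)
      rw [show L + (k - L) = k by omega, Nat.zero_add] at h1
      have h2 : run i L (k - L) z = run i (L + 1) (k - (L + 1)) (g L (i ⟨L, hL.1⟩) z) := by
        rw [show k - L = (k - (L + 1)) + 1 by omega]
        exact run_succ i L _ z hL.1
      rw [← h2, ← h1]
      exact hz
    by_cases h2 : ∃ e : Fin n, ∃ i' : Fin k → Fin n, run i' (L + 1) (k - (L + 1)) (g L e z) ∈ X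
    · obtain ⟨e₁, he₁⟩ := h2
      refine ⟨{(⟨L, hL.1⟩, e₁)}, Finset.singleton_nonempty _, fun i hz le hle => ?_⟩
      rw [Finset.mem_singleton] at hle
      subst hle
      -- if `i L ≠ e₁`, two distinct exponents hit: the family would fix `z` at level `L`
      by_contra hne
      exact hL.2 (hfresh L hL.1 (i ⟨L, hL.1⟩) e₁ hne z ⟨i, key i hz⟩ he₁).2
    · refine ⟨{(⟨L, hL.1⟩, e₀)}, Finset.singleton_nonempty _, fun i hz le _ => ?_⟩
      exact absurd ⟨i ⟨L, hL.1⟩, i, key i hz⟩ h2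
  · -- Case B: every level fixes `z`; then `z` is bad only if `z ∈ X`, excluded by the loci
    push Not at hA
    refine ⟨{(⟨0, hk⟩, e₀)}, Finset.singleton_nonempty _, fun i hz le _ => ?_⟩
    exfalso
    have hzX : z ∈ X := by
      have h1 : run i 0 (k + 0) z = run i (0 + k) 0 z :=
        hskip i z k 0 0 (by omega) (fun l' _ hl' e => hA l' (by omega) e)
      have h3 : k + 0 = k := Nat.add_zero _
      have h4 : 0 + k = k := Nat.zero_add _
      rw [h3, h4, run_zero] at h1
      rw [← h1]
      exact hz
    obtain ⟨l, hl, hzT⟩ := hT z hzX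
    -- at level `l` two distinct exponents hit the target (everything fixes `z`), so `z ∈ T l`
    have hhit : ∀ e : Fin n, ∃ i' : Fin k → Fin n, run i' (l + 1) (k - (l + 1)) (g l e z) ∈ X := by
      intro e
      refine ⟨i, ?_⟩
      rw [hA l hl e]
      have h1 : run i (l + 1) ((k - (l + 1)) + 0) z = run i ((l + 1) + (k - (l + 1))) 0 z :=
        hskip i z (k - (l + 1)) (l + 1) 0 (by omega) (fun l' _ hl' e' => hA l' (by omega) e')
      have h2 : run i (l + 1) (k - (l + 1)) z = z := by
        have h3 : (k - (l + 1)) + 0 = k - (l + 1) := Nat.add_zero _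
        have h4 : (l + 1) + (k - (l + 1)) = k := by omega
        rw [h3, h4, run_zero] at h1
        exact h1
      rw [h2]
      exact hzX
    have hne : (⟨0, by omega⟩ : Fin n) ≠ ⟨1, hn⟩ := fun h => Nat.zero_ne_one (congrArg Fin.val h)
    exact hzT (hfresh l hl _ _ hne z (hhit _) (hhit _)).1

end Menu

end Literature.NumberTheory.DiophantineGeometry.GenEll
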